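import Summits.RiemannHypothesis.RiemannHypothesis.Theorems.GroundBartaPolarPerronFrobeniusThetaWindowTest
import Summits.RiemannHypothesis.RiemannHypothesis.Theorems.GroundBartaPolarPerronFrobeniusWindowImageTranslate
import Summits.RiemannHypothesis.RiemannHypothesis.Theorems.WeilGroundStateGroundStatesConvergeToXiExpClassHarmonic
import Mathlib.Analysis.Calculus.IteratedDeriv.Lemmas
import HarnessLib

/-!
# The window image of the smooth theta vector: translates, continuity, and reduction to a sup bound
(route `RiemannHypothesis/GroundBarta`, rung 3 `PolarPerronFrobenius`, stmt-RiemannHypothesis-18390 —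
theta-vector toolkit; prepares item `ThetaWindowImage` of the draft route `EvenThetaVisibilityPinning`,
stmt-RiemannHypothesis-19848)

With `Θ_a = Φχ_a` the smooth theta window vector and `κ_a = Φ(1 - χ_a)` its collar tail
(Theorems/GroundBartaPolarPerronFrobeniusThetaWindowTest.lean):

* `weilFunctional_translate_thetaWin`: `W(τ_u Θ_a) = -W(τ_u κ_a)` for every `u` — all translates of
  Riemann's kernel are Weil-harmonic (`phi_translate_harmonic`) and `W` is additive on the
  exponential class (`weilFunctional_sub_expClass`);
* `continuous_weilFunctional_translate`: for a Weil test `h`, `u ↦ W(τ_u h)` is continuous (polar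
  term explicit, prime term locally a finite sum, archimedean term by dominated convergence);
* `thetaWin_windowImage`: `W(g ⋆ Θ̃_a) = ∫ g(u) conj W(τ_u Θ_a) du` for every test `g`
  (`weilFunctional_weilConv_weilReflect_eq_integral_translate`), so the `L²` REPRESENTER of the
  window image on window-`a` tests is `T_a = 𝟙_{[-a,a]} · W(τ_· Θ_a) = -𝟙_{[-a,a]} · W(τ_· κ_a)`;
* `thetaWindowImage_of_translate_bound`: the statement of item `ThetaWindowImage` (token for
  token) FOLLOWS from a uniform bound `‖W(τ_u κ_a)‖ ≤ C x^C e^{-πx}` (`x = e^{2a}`) for `|u| ≤ a`,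
  `a ≥ a₀` — the analytic content left for the collar estimates.
RH-free.  References: Bombieri 2000 Thm 2; B. Riemann / de Bruijn (kernel `Φ`).
-/

set_option linter.dupNamespace false

noncomputable section

open Set MeasureTheory Filter Complex
open scoped Real Topology ComplexConjugate ArithmeticFunction.vonMangoldt

namespace Summit.RiemannHypothesis.RiemannHypothesis.Theorems.PolarPerronFrobenius

open Literature.NumberTheory.LFunctions
open Summit.RiemannHypothesis.RiemannHypothesis.Theorems.GroundBartaFloor
open Summit.RiemannHypothesis.RiemannHypothesis.Theorems.GroundStatesConvergeToXi

/-- The smooth theta window vector `Θ_a = Φ χ_a`, complexified, in the spelling of the route files. -/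
local notation "Θ[" a "]" => (fun t : ℝ =>
  ((weilThetaPhi t * Real.smoothTransition ((a - t) * Real.exp (2 * a)) *
    Real.smoothTransition ((a + t) * Real.exp (2 * a)) : ℝ) : ℂ))

/-- The collar tail `κ_a = Φ (1 - χ_a)`, complexified. -/
local notation "κ[" a "]" => (fun t : ℝ =>
  ((weilThetaPhi t * (1 - Real.smoothTransition ((a - t) * Real.exp (2 * a)) *
    Real.smoothTransition ((a + t) * Real.exp (2 * a))) : ℝ) : ℂ))

/-! ## Translates stay in the exponential class -/

/-- Translating an exponential-class envelope: if every derivative of `F` is `O(e^{-|t|})` then so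
is every derivative of `τ_u F = F(· + u)` (constant multiplied by `e^{|u|}`). [folklore] -/
theorem twi_envelope_translate {F : ℝ → ℂ}
    (hF : ∀ k : ℕ, ∃ C : ℝ, ∀ t : ℝ, ‖iteratedDeriv k F t‖ ≤ C * Real.exp (-(1 * |t|))) (u : ℝ) :
    ∀ k : ℕ, ∃ C : ℝ, ∀ t : ℝ,
      ‖iteratedDeriv k (fun t => F (t + u)) t‖ ≤ C * Real.exp (-(1 * |t|)) := by
  intro k
  obtain ⟨C, hC⟩ := hF k
  have hC0 : 0 ≤ C := by
    have h : (0 : ℝ) ≤ C * Real.exp (-(1 * |(0 : ℝ)|)) := (norm_nonneg _).trans (hC 0)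
    simpa using h
  refine ⟨C * Real.exp (|u|), fun t => ?_⟩
  rw [iteratedDeriv_comp_add_const k F u]
  refine (hC (t + u)).trans ?_
  rw [mul_assoc, ← Real.exp_add]
  refine mul_le_mul_of_nonneg_left (Real.exp_le_exp.2 ?_) hC0
  have h1 : |t| ≤ |t + u| + |u| := by
    calc |t| = |(t + u) + (-u)| := by ring_nf
      _ ≤ |t + u| + |-u| := abs_add_le _ _
      _ = |t + u| + |u| := by rw [abs_neg]
  linarith

/-! ## `W(τ_u Θ_a) = -W(τ_u κ_a)` -/

/-- Riemann's kernel, complexified, is smooth with every derivative `O(e^{-|t|})` (tree: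
`contDiff_phi`, `stub_phi_iteratedDeriv_envelope`, in the `weilThetaPhi` spelling). [folklore] -/
theorem twi_phi_class :
    ContDiff ℝ (⊤ : ℕ∞) (fun t : ℝ => ((weilThetaPhi t : ℝ) : ℂ)) ∧
      ∀ k : ℕ, ∃ C : ℝ, ∀ t : ℝ,
        ‖iteratedDeriv k (fun t : ℝ => ((weilThetaPhi t : ℝ) : ℂ)) t‖ ≤ C * Real.exp (-(1 * |t|)) := by
  have hΦeq : (fun t : ℝ => ((weilThetaPhi t : ℝ) : ℂ)) =
      fun t : ℝ => (2 : ℂ) * LagariasMontague.Psic (2 * t) := funext leakEnv_ofReal_weilThetaPhi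
  rw [hΦeq]
  exact ⟨contDiff_phi, stub_phi_iteratedDeriv_envelope⟩

/-- **The translates of the smooth theta window vector against Weil's functional**: for every `u`,
`W(τ_u Θ_a) = -W(τ_u κ_a)` — all translates of Riemann's kernel are Weil-harmonic
(`phi_translate_harmonic`) and `W` is additive on the exponential class. [folklore] -/
theorem weilFunctional_translate_thetaWin (a u : ℝ) :
    weilFunctional (fun t => Θ[a] (t + u)) = -weilFunctional (fun t => κ[a] (t + u)) := by
  obtain ⟨hκc, hκb⟩ := thetaWin_tail_class a
  obtain ⟨hΦc, hΦb⟩ := twi_phi_class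
  have hFc : ContDiff ℝ (⊤ : ℕ∞) (fun t : ℝ => ((weilThetaPhi (t + u) : ℝ) : ℂ)) :=
    hΦc.comp (contDiff_id.add contDiff_const)
  have hFb := twi_envelope_translate hΦb u
  have hGc : ContDiff ℝ (⊤ : ℕ∞) (fun t : ℝ => κ[a] (t + u)) :=
    hκc.comp (contDiff_id.add contDiff_const)
  have hGb := twi_envelope_translate hκb u
  have hsub : (fun t => Θ[a] (t + u)) =
      fun t => ((weilThetaPhi (t + u) : ℝ) : ℂ) - κ[a] (t + u) := by
    funext t
    push_cast
    ring
  have hW0 : weilFunctional (fun t : ℝ => ((weilThetaPhi (t + u) : ℝ) : ℂ)) = 0 := by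
    have e : (fun t : ℝ => ((weilThetaPhi (t + u) : ℝ) : ℂ)) =
        fun t : ℝ => (2 : ℂ) * LagariasMontague.Psic (2 * (t + u)) :=
      funext fun t => leakEnv_ofReal_weilThetaPhi (t + u)
    rw [e]
    exact phi_translate_harmonic u
  rw [hsub, weilFunctional_sub_expClass hFc hGc (by norm_num : (1 : ℝ) / 2 < 1) hFb hGb, hW0,
    zero_sub]

/-! ## Continuity of the window image of a test kernel -/

/-- **The window image `u ↦ W(τ_u h)` of a Weil test `h` is continuous**: the polar term of the
translate is `e^{u/2}ĥ(0) + e^{-u/2}ĥ(1)`, the prime term is locally a FINITE sum of translates of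
`h`, and the archimedean integral `∫ e^{-itu} ĥ(1/2+it) Re ψ(1/4+it/2) dt` is continuous by dominated
convergence. [folklore] -/
theorem continuous_weilFunctional_translate {h : ℝ → ℂ} (hh : IsWeilTest h) :
    Continuous fun u : ℝ => weilFunctional (fun t => h (t + u)) := by
  -- polar
  have hP : Continuous fun u : ℝ => weilPolarTerm (fun t => h (t + u)) := by
    have e : (fun u : ℝ => weilPolarTerm (fun t => h (t + u))) = fun u : ℝ =>
        cexp ((u : ℂ) / 2) * weilMellin h 0 + cexp (-((u : ℂ) / 2)) * weilMellin h 1 :=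
      funext fun u => wi_weilPolarTerm_translate h u
    rw [e]
    fun_prop
  -- prime: locally a finite sum
  have hPr : Continuous fun u : ℝ => weilPrimeTerm (fun t => h (t + u)) := by
    obtain ⟨Rh, hRh0, hRh⟩ := wi_exists_radius hh.2
    refine continuous_iff_continuousAt.2 fun u₀ => ?_
    set N : ℕ := ⌈Real.exp ((|u₀| + 1) + Rh + 1)⌉₊ with hN
    set S : Finset ℕ := Finset.range N with hS
    have hlog : ∀ n, n ∉ S → (|u₀| + 1) + Rh + 1 ≤ Real.log n := by
      intro n hn
      rw [hS, Finset.mem_range, not_lt] at hn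
      have hn' : Real.exp ((|u₀| + 1) + Rh + 1) ≤ n := (Nat.le_ceil _).trans (by exact_mod_cast hn)
      have hpos : (0 : ℝ) < n := (Real.exp_pos _).trans_le hn'
      rwa [Real.le_log_iff_exp_le hpos]
    have hloc : ∀ u : ℝ, |u| ≤ |u₀| + 1 → weilPrimeTerm (fun t => h (t + u)) =
        ∑ n ∈ S, ((Λ n : ℝ) : ℂ) / (Real.sqrt n : ℂ) * (h (Real.log n + u) + h (-Real.log n + u)) := by
      intro u hu
      unfold weilPrimeTerm
      refine tsum_eq_sum fun n hn => ?_
      have hl := hlog n hn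
      have hu' := abs_le.1 hu
      have e1 : h (Real.log n + u) = 0 := by
        by_contra hne
        have h1 := abs_le.1 (hRh _ hne)
        linarith [h1.2]
      have e2 : h (-Real.log n + u) = 0 := by
        by_contra hne
        have h1 := abs_le.1 (hRh _ hne)
        linarith [h1.1]
      simp only [e1, e2, add_zero, mul_zero]
    have hcont : Continuous fun u : ℝ => ∑ n ∈ S, ((Λ n : ℝ) : ℂ) / (Real.sqrt n : ℂ) *
        (h (Real.log n + u) + h (-Real.log n + u)) := by
      refine continuous_finsetSum _ fun n _ => ?_
      have h1 : Continuous fun u : ℝ => h (Real.log n + u) :=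
        hh.1.continuous.comp (continuous_const.add continuous_id)
      have h2 : Continuous fun u : ℝ => h (-Real.log n + u) :=
        hh.1.continuous.comp (continuous_const.add continuous_id)
      exact continuous_const.mul (h1.add h2)
    refine hcont.continuousAt.congr ?_
    filter_upwards [Metric.ball_mem_nhds u₀ one_pos] with u hu
    rw [Metric.mem_ball, Real.dist_eq] at hu
    have hu' : |u| ≤ |u₀| + 1 := by
      have := abs_sub_abs_le_abs_sub u u₀
      linarith
    exact (hloc u hu').symm
  -- archimedean: dominated convergence for the parametric integral
  have hA : Continuous fun u : ℝ => weilArchTerm (fun t => h (t + u)) := by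
    obtain ⟨hFc, C, hFb⟩ := wi_digammaWeight
    set ψF : ℝ → ℂ := fun t => ((Complex.digamma (1 / 4 + t / 2 * I)).re : ℂ) with hψF
    have hI := RuelleBandCofiniteCriticalLine.stub_branchesContinuous_integrable_weilArchIntegrand hh
    have hMc : Continuous fun t : ℝ => weilMellin h (1 / 2 + t * I) := by
      have h1 := continuous_weilMellin_vertical hh.1.continuous hh.2 (1 / 2)
      refine h1.congr fun t => ?_
      push_cast
      ring_nf
    have hAI : Continuous fun u : ℝ => weilArchIntegral (fun t => h (t + u)) := by
      have e : (fun u : ℝ => weilArchIntegral (fun t => h (t + u))) = fun u : ℝ =>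
          ∫ t : ℝ, cexp (-(((t * u : ℝ) : ℂ) * I)) * weilMellin h (1 / 2 + t * I) * ψF t :=
        funext fun u => wi_weilArchIntegral_translate h u
      rw [e]
      refine continuous_of_dominated (bound := fun t => ‖weilMellin h (1 / 2 + t * I) * ψF t‖)
        (fun u => ?_) (fun u => Eventually.of_forall fun t => ?_) hI.norm
        (Eventually.of_forall fun t => ?_)
      · exact (((by fun_prop : Continuous fun t : ℝ => cexp (-(((t * u : ℝ) : ℂ) * I))).mul
          hMc).mul hFc).aestronglyMeasurable
      · rw [norm_mul, norm_mul, norm_mul, Complex.norm_exp]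
        have : (-(((t * u : ℝ) : ℂ) * I)).re = 0 := by simp
        rw [this, Real.exp_zero, one_mul]
      · fun_prop
    have e : (fun u : ℝ => weilArchTerm (fun t => h (t + u))) = fun u : ℝ =>
        (1 / (2 * π) : ℂ) * weilArchIntegral (fun t => h (t + u)) - h (0 + u) * (Real.log π : ℂ) :=
      funext fun u => by rw [weilArchTerm]
    rw [e]
    have h0 : Continuous fun u : ℝ => h (0 + u) := hh.1.continuous.comp (continuous_const.add continuous_id)
    exact (continuous_const.mul hAI).sub (h0.mul continuous_const)
  have e : (fun u : ℝ => weilFunctional (fun t => h (t + u))) = fun u : ℝ =>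
      weilPolarTerm (fun t => h (t + u)) - weilPrimeTerm (fun t => h (t + u)) +
        weilArchTerm (fun t => h (t + u)) := funext fun u => by rw [weilFunctional]
  rw [e]
  exact (hP.sub hPr).add hA

/-! ## The window image of `Θ_a` and the reduction of `ThetaWindowImage` to a collar bound -/

/-- **Window image of the smooth theta vector**: `W(g ⋆ Θ̃_a) = ∫ g(u) conj W(τ_u Θ_a) du` for every
Weil test `g` — the `L²`-representer of `g ↦ W(g ⋆ Θ̃_a)` on window tests is
`u ↦ W(τ_u Θ_a) = -W(τ_u κ_a)`. [folklore] -/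
theorem thetaWin_windowImage {g : ℝ → ℂ} (hg : IsWeilTest g) (a : ℝ) :
    weilFunctional (weilConv g (weilReflect Θ[a])) =
      ∫ u, g u * conj (weilFunctional (fun t => Θ[a] (t + u))) :=
  weilFunctional_weilConv_weilReflect_eq_integral_translate hg (thetaWin_isWeilTest a)

/-- **Reduction of `ThetaWindowImage` to a collar estimate.**  If for `a ≥ a₀ (≥ 1/2)` and `|u| ≤ a`
the translates of the collar tail satisfy `‖W(τ_u κ_a)‖ ≤ C x^p e^{-πx}` (`x = e^{2a}`, `C ≥ 0`),
then the statement of item `ThetaWindowImage` (draft route `EvenThetaVisibilityPinning`,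
stmt-RiemannHypothesis-19848) holds, token for token: `Θ_a` is a Weil test and
`T_a = 𝟙_{[-a,a]} · W(τ_· Θ_a) ∈ L²` represents its even window image with
`‖T_a‖₂ ≤ √(2a) C x^p e^{-πx} ≤ C' x^{C'} e^{-πx}`, `C' = max (max C (p+1)) 1`. [folklore] -/
theorem thetaWindowImage_of_translate_bound {C p a₀ : ℝ} (hC : 0 ≤ C) (ha₀ : 1 / 2 ≤ a₀)
    (hB : ∀ a : ℝ, a₀ ≤ a → ∀ u : ℝ, |u| ≤ a →
      ‖weilFunctional (fun t => κ[a] (t + u))‖ ≤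
        C * Real.exp (2 * a) ^ p * Real.exp (-(Real.pi * Real.exp (2 * a)))) :
    ∃ C a₀ : ℝ, ∀ a : ℝ, a₀ ≤ a → Literature.NumberTheory.LFunctions.IsWeilTest (fun t : ℝ => ((Literature.NumberTheory.LFunctions.weilThetaPhi t * Real.smoothTransition ((a - t) * Real.exp (2 * a)) * Real.smoothTransition ((a + t) * Real.exp (2 * a)) : ℝ) : ℂ)) ∧ ∃ T : ℝ → ℂ, MeasureTheory.MemLp T 2 ∧ Real.sqrt (∫ t, ‖T t‖ ^ 2) ≤ C * Real.exp (2 * a) ^ C * Real.exp (-(Real.pi * Real.exp (2 * a))) ∧ ∀ g : ℝ → ℂ, Literature.NumberTheory.LFunctions.IsWeilTest g → tsupport g ⊆ Set.Icc (-a) a → (∀ t, g (-t) = g t) → Literature.NumberTheory.LFunctions.weilFunctional (Literature.NumberTheory.LFunctions.weilConv g (Literature.NumberTheory.LFunctions.weilReflect (fun t : ℝ => ((Literature.NumberTheory.LFunctions.weilThetaPhi t * Real.smoothTransition ((a - t) * Real.exp (2 * a)) * Real.smoothTransition ((a + t) * Real.exp (2 * a)) : ℝ) : ℂ)))) = ∫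 t, g t * (starRingEnd ℂ) (T t) := by
  set C' : ℝ := max (max C (p + 1)) 1 with hC'
  refine ⟨C', a₀, fun a ha => ⟨thetaWin_isWeilTest a, ?_⟩⟩
  have ha0 : 0 < a := by linarith
  set x : ℝ := Real.exp (2 * a) with hx
  have hx1 : 1 ≤ x := Real.one_le_exp (by linarith)
  set B : ℝ := C * x ^ p * Real.exp (-(Real.pi * x)) with hBdef
  have hB0 : 0 ≤ B := by positivity
  -- the representer
  set W : ℝ → ℂ := fun u => weilFunctional (fun t => Θ[a] (t + u)) with hW
  set T : ℝ → ℂ := (Icc (-a) a).indicator W with hT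
  have hWc : Continuous W := continuous_weilFunctional_translate (thetaWin_isWeilTest a)
  have hWB : ∀ u ∈ Icc (-a) a, ‖W u‖ ≤ B := fun u hu => by
    rw [hW]
    dsimp only
    rw [weilFunctional_translate_thetaWin, norm_neg]
    exact hB a ha u (abs_le.2 ⟨hu.1, hu.2⟩)
  -- `T ∈ L²`
  have hTm : MemLp T 2 volume := by
    rw [hT, memLp_indicator_iff_restrict measurableSet_Icc]
    exact MemLp.of_bound hWc.aestronglyMeasurable.restrict B
      ((ae_restrict_iff' measurableSet_Icc).2 (Eventually.of_forall hWB))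
  -- `‖T‖₂ ≤ √(2a) B`
  have hnorm : Real.sqrt (∫ t, ‖T t‖ ^ 2) ≤ Real.sqrt (2 * a) * B := by
    have h1 : ∫ t, ‖T t‖ ^ 2 = ∫ t in Icc (-a) a, ‖W t‖ ^ 2 := by
      rw [← integral_indicator measurableSet_Icc]
      congr 1 with t
      by_cases ht : t ∈ Icc (-a) a
      · simp [hT, indicator_of_mem ht]
      · simp [hT, indicator_of_notMem ht]
    have hbd : ∀ t ∈ Icc (-a) a, ‖‖W t‖ ^ 2‖ ≤ B ^ 2 := fun t ht => by
      rw [Real.norm_eq_abs, abs_of_nonneg (by positivity)]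
      exact pow_le_pow_left₀ (norm_nonneg _) (hWB t ht) 2
    have h2 := norm_setIntegral_le_of_norm_le_const (μ := (volume : Measure ℝ))
      (measure_Icc_lt_top (a := -a) (b := a)) hbd
    rw [Real.volume_real_Icc_of_le (by linarith), show a - -a = 2 * a by ring] at h2
    have h3 : ∫ t, ‖T t‖ ^ 2 ≤ B ^ 2 * (2 * a) := by
      rw [h1]
      exact (le_abs_self _).trans (by simpa [Real.norm_eq_abs] using h2)
    calc Real.sqrt (∫ t, ‖T t‖ ^ 2) ≤ Real.sqrt (B ^ 2 * (2 * a)) := Real.sqrt_le_sqrt h3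
      _ = B * Real.sqrt (2 * a) := by
          rw [Real.sqrt_mul (sq_nonneg B), Real.sqrt_sq hB0]
      _ = Real.sqrt (2 * a) * B := mul_comm _ _
  -- `√(2a) B ≤ C' x^{C'} e^{-πx}`
  have hgrow : Real.sqrt (2 * a) * B ≤ C' * x ^ C' * Real.exp (-(Real.pi * x)) := by
    have h2a : Real.sqrt (2 * a) ≤ x := by
      have h1 : 2 * a ≤ x := by
        have := Real.add_one_le_exp (2 * a)
        rw [hx]; linarith
      have h2 : Real.sqrt (2 * a) ≤ Real.sqrt x := Real.sqrt_le_sqrt h1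
      have h3 : Real.sqrt x ≤ x := by
        rw [Real.sqrt_le_left (by linarith)]
        nlinarith
      exact h2.trans h3
    have hxp : x * x ^ p = x ^ (p + 1) := by
      rw [Real.rpow_add (by linarith), Real.rpow_one, mul_comm]
    have hCle : C ≤ C' := (le_max_left _ _).trans (le_max_left _ _)
    have hp1 : p + 1 ≤ C' := (le_max_right _ _).trans (le_max_left _ _)
    have hxpow : x ^ (p + 1) ≤ x ^ C' := Real.rpow_le_rpow_of_exponent_le hx1 hp1
    calc Real.sqrt (2 * a) * B ≤ x * B := mul_le_mul_of_nonneg_right h2a hB0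
      _ = C * (x * x ^ p) * Real.exp (-(Real.pi * x)) := by rw [hBdef]; ring
      _ = C * x ^ (p + 1) * Real.exp (-(Real.pi * x)) := by rw [hxp]
      _ ≤ C' * x ^ C' * Real.exp (-(Real.pi * x)) := by
          gcongr
  refine ⟨T, hTm, hnorm.trans hgrow, fun g hg hgs _ => ?_⟩
  -- the representer identity on window tests
  rw [thetaWin_windowImage hg a]
  congr 1 with u
  by_cases hu : u ∈ Icc (-a) a
  · simp [hT, indicator_of_mem hu, hW]
  · have hg0 : g u = 0 := image_eq_zero_of_notMem_tsupport fun h' => hu (hgs h')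
    simp [hg0]

end Summit.RiemannHypothesis.RiemannHypothesis.Theorems.PolarPerronFrobenius

end
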